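import Summits.ResolutionOfSingularities.ResolutionOfSingularities.Theorems.EquisingularLiftEquisingularLiftNatSpecimenNodalConeAlgebra
import Summits.ResolutionOfSingularities.ResolutionOfSingularities.Theorems.EquisingularLiftEquisingularLiftNatNoseTowerBTriplePrimeDoubleLine
import Summits.ResolutionOfSingularities.ResolutionOfSingularities.Theorems.EquisingularLiftEquisingularLiftNatDoubleLineBlowupCharts
import Summits.ResolutionOfSingularities.ResolutionOfSingularities.Theorems.EquisingularLiftEquisingularLiftNatSpecimenWhitneyCubicForms
import HarnessLib

/-!
# [OURS · L1 W4.5(b) · EL♮(3)] NOSE ENGINE CERTIFICATION ‖ K, specimen 4 — the NODAL CUBIC CONE `(x₀ + x₁)x₂x₃ + x₂³ + x₃³`: `ReachNoseTowerBTriplePrime` and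
# EL♮ through the generic double-line files — completing the kernel census of the FOUR classical types of integral cubic surfaces with a double line

Cell `res-hironaka`, slot W4.5(b); crux **EL♮(3)** (stmt-ResolutionOfSingularities-20148; parent EL♮ stmt-…-20038); width seat res-L1-w45b-nose-w3, row
«NOSE ENGINE CERT ‖ K» of res-L1-w45b-plan-1's WIDTH TABLE D1′. `--supports stmt-ResolutionOfSingularities-20148 --as helper`; closes nothing. OURS; NOT a
statement of any manuscript; AI-written, weaker than expert review. One `def` (the form), no `sorry`, standard axioms.

The specimen `H = V₊(F)`, `F = (x₀ + x₁)x₂x₃ + x₂³ + x₃³` — the CONE (vertex `[1:−1:0:0]`) over the NODAL plane cubic `zuv + u³ + v³`, singular along the double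
line `Σ = V(x₂, x₃)` (transversal `A₁`, triple point at the vertex). With R2 (`WhitneyCubic`, general cubic scroll), `CuspCone` (cone over the cuspidal cubic)
and `CayleyRuled` (Cayley's cubic scroll) this is the last of the four classical projective types of INTEGRAL CUBIC SURFACES WITH ONE-DIMENSIONAL SINGULAR
LOCUS over an algebraically closed field (the classification is quoted, NOT formalised: typed ≠ proved); all four now carry kernel certificates of the
B‴ nose predicate and of EL♮, in every characteristic.

* `form`, `isHomogeneous_form`, `prime_form` (degree one in `x₀`, coefficient `x₂x₃` vs `x₁x₂x₃ + x₂³ + x₃³`), `form_mem_span`, `X_two_not_mem_span_form`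
  (evaluation at `(0,0,1,−1)`), `dehomogenize_form_*` (`= g, g, g₂, g₃` of `…NatSpecimenNodalConeAlgebra`), `radical_dehomogenize`, `isRegularRing_chartRing_of_two_le`;
* `isRegular_blowups` — `DoubleLine.isRegular_of_isBlowup_comap_vanishingIdeal` (p645742), ONE application;
* ★ **`reachNoseTowerBTriplePrime_nodalCone`** — `ReachNoseTowerBTriplePrime K 3 H ι` (any field): fourth kernel inhabitant of the B‴ nose predicate;
* ★ **`elNatAt_nodalCone`** — `ELNatAt p K 3 H ι`, `K` algebraically closed of characteristic `p`, ANY `p` (p645692 ∘ rung p524326).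
-/

set_option linter.dupNamespace false -- mandated namespace `Summit.<Summit>.<Problem>` of this single-conjunct summit

noncomputable section

open CategoryTheory CategoryTheory.Limits AlgebraicGeometry TopologicalSpace
open MvPolynomial HomogeneousLocalization
open Literature.AlgebraicGeometry.Resolution
open Literature.AlgebraicGeometry.Motives Literature.AlgebraicGeometry.Motives.SmoothHypersurface
open Literature.AlgebraicGeometry.Motives.ProjectiveSpace
open AlgebraicGeometry.Scheme.IdealSheafData

namespace Summit.ResolutionOfSingularities.ResolutionOfSingularities.Cruxes.EquisingularLiftNat.Sections

namespace NodalCone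

variable (k : Type) [Field k]

attribute [local instance] MvPolynomial.gradedAlgebra ProjBaseChange.algebraBase

/-! ## The form `F = (x₀ + x₁)x₂x₃ + x₂³ + x₃³` -/

/-- **The nodal cubic cone form** `F = (x₀ + x₁)x₂x₃ + x₂³ + x₃³ ∈ k[x₀, x₁, x₂, x₃]` (vertex `[1:−1:0:0]`; double line `V(x₂, x₃)`). [folklore] -/
def form : MvPolynomial (Fin 4) k := (X 0 + X 1) * X 2 * X 3 + X 2 ^ 3 + X 3 ^ 3

/-- `F` is homogeneous of degree `3`. [folklore] -/
theorem isHomogeneous_form : (NodalCone.form k).IsHomogeneous 3 := by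
  have h0 : (X 0 * X 2 * X 3 : MvPolynomial (Fin 4) k).IsHomogeneous 3 := by
    simpa using ((isHomogeneous_X k (0 : Fin 4)).mul (isHomogeneous_X k (2 : Fin 4))).mul (isHomogeneous_X k (3 : Fin 4))
  have h1 : (X 1 * X 2 * X 3 : MvPolynomial (Fin 4) k).IsHomogeneous 3 := by
    simpa using ((isHomogeneous_X k (1 : Fin 4)).mul (isHomogeneous_X k (2 : Fin 4))).mul (isHomogeneous_X k (3 : Fin 4))
  have h2 : (X 2 ^ 3 : MvPolynomial (Fin 4) k).IsHomogeneous 3 := by simpa using (isHomogeneous_X k (2 : Fin 4)).pow 3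
  have h3 : (X 3 ^ 3 : MvPolynomial (Fin 4) k).IsHomogeneous 3 := by simpa using (isHomogeneous_X k (3 : Fin 4)).pow 3
  have h : NodalCone.form k = X 0 * X 2 * X 3 + X 1 * X 2 * X 3 + X 2 ^ 3 + X 3 ^ 3 := by rw [NodalCone.form]; ring
  rw [h]
  exact ((h0.add h1).add h2).add h3

/-- In `x₀`-adic form: `F = C(y₁y₂)·Y + C(y₀y₁y₂ + y₁³ + y₂³)` over `k[y₀, y₁, y₂]` (`y = (x₁, x₂, x₃)`). [folklore] -/
theorem finSuccEquiv_form :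
    finSuccEquiv k 3 (NodalCone.form k) = Polynomial.C (X 1 * X 2) * Polynomial.X + Polynomial.C (X 0 * X 1 * X 2 + X 1 ^ 3 + X 2 ^ 3) := by
  have h1 : finSuccEquiv k 3 (X 1) = Polynomial.C (X 0) := finSuccEquiv_X_succ (j := 0)
  have h2 : finSuccEquiv k 3 (X 2) = Polynomial.C (X 1) := finSuccEquiv_X_succ (j := 1)
  have h3 : finSuccEquiv k 3 (X 3) = Polynomial.C (X 2) := finSuccEquiv_X_succ (j := 2)
  simp only [NodalCone.form, map_add, map_mul, map_pow, finSuccEquiv_X_zero, h1, h2, h3]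
  ring

/-- The coefficients `y₁y₂` and `y₀y₁y₂ + y₁³ + y₂³` are relatively prime in `k[y₀, y₁, y₂]` (`y₁ ∤ y₂³`, `y₂ ∤ y₁³`). [folklore] -/
theorem isRelPrime_coeff₃ : IsRelPrime (X 1 * X 2 : MvPolynomial (Fin 3) k) (X 0 * X 1 * X 2 + X 1 ^ 3 + X 2 ^ 3) := by
  have hp1 : Prime (X 1 : MvPolynomial (Fin 3) k) := X_prime
  have hp2 : Prime (X 2 : MvPolynomial (Fin 3) k) := X_prime
  have hd1 : (X 1 : MvPolynomial (Fin 3) k) ∣ X 0 * X 1 * X 2 := Dvd.dvd.mul_right (dvd_mul_left (X 1) (X 0)) (X 2)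
  have hd2 : (X 2 : MvPolynomial (Fin 3) k) ∣ X 0 * X 1 * X 2 := dvd_mul_left (X 2) (X 0 * X 1)
  have h1 : ¬ ((X 1 : MvPolynomial (Fin 3) k) ∣ X 0 * X 1 * X 2 + X 1 ^ 3 + X 2 ^ 3) := by
    intro h
    have h' : (X 1 : MvPolynomial (Fin 3) k) ∣ X 2 ^ 3 :=
      (dvd_add_right (dvd_add hd1 (dvd_pow_self (X 1) three_ne_zero))).mp h
    exact absurd (X_dvd_X.mp (hp1.dvd_of_dvd_pow h')) (by decide)
  have h2 : ¬ ((X 2 : MvPolynomial (Fin 3) k) ∣ X 0 * X 1 * X 2 + X 1 ^ 3 + X 2 ^ 3) := by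
    intro h
    have h' : (X 2 : MvPolynomial (Fin 3) k) ∣ X 0 * X 1 * X 2 + X 1 ^ 3 := (dvd_add_left (dvd_pow_self (X 2) three_ne_zero)).mp h
    have h'' : (X 2 : MvPolynomial (Fin 3) k) ∣ X 1 ^ 3 := (dvd_add_right hd2).mp h'
    exact absurd (X_dvd_X.mp (hp2.dvd_of_dvd_pow h'')) (by decide)
  exact (CayleyRuled.isRelPrime_of_prime_of_not_dvd hp1 h1).mul_left (CayleyRuled.isRelPrime_of_prime_of_not_dvd hp2 h2)

/-- **`F` is prime** (degree one in `x₀` with relatively prime coefficients). [folklore] -/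
theorem prime_form : Prime (NodalCone.form k) := by
  have hirr : Irreducible (NodalCone.form k) := by
    rw [← MulEquiv.irreducible_iff (finSuccEquiv k 3), finSuccEquiv_form]
    exact Polynomial.irreducible_C_mul_X_add_C (mul_ne_zero (X_ne_zero 1) (X_ne_zero 2)) (isRelPrime_coeff₃ k)
  exact UniqueFactorizationMonoid.irreducible_iff_prime.mp hirr

/-- `F ∈ (x₂, x₃)`. [folklore] -/
theorem form_mem_span : NodalCone.form k ∈ Ideal.span {(X 2 : MvPolynomial (Fin 4) k), X 3} := by
  have h2 : (X 2 : MvPolynomial (Fin 4) k) ∈ Ideal.span {(X 2 : MvPolynomial (Fin 4) k), X 3} := Ideal.subset_span (by simp)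
  have h3 : (X 3 : MvPolynomial (Fin 4) k) ∈ Ideal.span {(X 2 : MvPolynomial (Fin 4) k), X 3} := Ideal.subset_span (by simp)
  rw [NodalCone.form]
  refine Ideal.add_mem _ (Ideal.add_mem _ ?_ ?_) ?_
  · exact Ideal.mul_mem_left _ _ h3
  · exact Ideal.pow_mem_of_mem _ h2 3 three_pos
  · exact Ideal.pow_mem_of_mem _ h3 3 three_pos

/-- `x₂ ∉ (F)`: evaluate at `(0, 0, 1, −1)` (`F ↦ 0`, `x₂ ↦ 1`). [folklore] -/
theorem X_two_not_mem_span_form : (X 2 : MvPolynomial (Fin 4) k) ∉ Ideal.span {NodalCone.form k} := by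
  intro h
  obtain ⟨q, hq⟩ := Ideal.mem_span_singleton'.mp h
  have h := congrArg (MvPolynomial.eval ![(0 : k), 0, 1, -1]) hq
  rw [NodalCone.form] at h
  simp at h
  norm_num at h

/-! ## The dehomogenized equations -/

/-- `F(x₀ := 1) = g = (y₀ + 1)y₁y₂ + y₁³ + y₂³` (`y = (x₁, x₂, x₃)`). [folklore] -/
theorem dehomogenize_form_zero : dehomogenize k (0 : Fin 4) (NodalCone.form k) = g k := by
  simp only [NodalCone.form, g, map_add, map_mul, map_pow, dehomogenize_X_self,
    WhitneyCubic.dehomogenize_X_of_eq k 0 1 0 (by decide), WhitneyCubic.dehomogenize_X_of_eq k 0 2 1 (by decide),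
    WhitneyCubic.dehomogenize_X_of_eq k 0 3 2 (by decide)]
  ring

/-- `F(x₁ := 1) = g = (y₀ + 1)y₁y₂ + y₁³ + y₂³` (`y = (x₀, x₂, x₃)`). [folklore] -/
theorem dehomogenize_form_one : dehomogenize k (1 : Fin 4) (NodalCone.form k) = g k := by
  simp only [NodalCone.form, g, map_add, map_mul, map_pow, dehomogenize_X_self,
    WhitneyCubic.dehomogenize_X_of_eq k 1 0 0 (by decide), WhitneyCubic.dehomogenize_X_of_eq k 1 2 1 (by decide),
    WhitneyCubic.dehomogenize_X_of_eq k 1 3 2 (by decide)]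

/-- `F(x₂ := 1) = g₂ = (y₀ + y₁)y₂ + 1 + y₂³` (`y = (x₀, x₁, x₃)`). [folklore] -/
theorem dehomogenize_form_two : dehomogenize k (2 : Fin 4) (NodalCone.form k) = g₂ k := by
  simp only [NodalCone.form, g₂, map_add, map_mul, map_pow, dehomogenize_X_self,
    WhitneyCubic.dehomogenize_X_of_eq k 2 0 0 (by decide), WhitneyCubic.dehomogenize_X_of_eq k 2 1 1 (by decide),
    WhitneyCubic.dehomogenize_X_of_eq k 2 3 2 (by decide), one_pow, mul_one]

/-- `F(x₃ := 1) = g₃ = (y₀ + y₁)y₂ + y₂³ + 1` (`y = (x₀, x₁, x₂)`). [folklore] -/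
theorem dehomogenize_form_three : dehomogenize k (3 : Fin 4) (NodalCone.form k) = g₃ k := by
  simp only [NodalCone.form, g₃, map_add, map_mul, map_pow, dehomogenize_X_self,
    WhitneyCubic.dehomogenize_X_of_eq k 3 0 0 (by decide), WhitneyCubic.dehomogenize_X_of_eq k 3 1 1 (by decide),
    WhitneyCubic.dehomogenize_X_of_eq k 3 2 2 (by decide), one_pow, mul_one]

/-- All four dehomogenisations span radical ideals (the locally-principal binder). [folklore] -/
theorem radical_dehomogenize (c : Fin (2 + 2)) :
    (Ideal.span {dehomogenize k c (NodalCone.form k)}).radical = Ideal.span {dehomogenize k c (NodalCone.form k)} := by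
  fin_cases c
  · exact (congrArg (fun q => (Ideal.span {q}).radical) (dehomogenize_form_zero k)).trans
      ((radical_span_g k).trans (congrArg (fun q => Ideal.span {q}) (dehomogenize_form_zero k).symm))
  · exact (congrArg (fun q => (Ideal.span {q}).radical) (dehomogenize_form_one k)).trans
      ((radical_span_g k).trans (congrArg (fun q => Ideal.span {q}) (dehomogenize_form_one k).symm))
  · exact (congrArg (fun q => (Ideal.span {q}).radical) (dehomogenize_form_two k)).trans
      ((radical_span_g₂ k).trans (congrArg (fun q => Ideal.span {q}) (dehomogenize_form_two k).symm))
  · exact (congrArg (fun q => (Ideal.span {q}).radical) (dehomogenize_form_three k)).trans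
      ((radical_span_g₃ k).trans (congrArg (fun q => Ideal.span {q}) (dehomogenize_form_three k).symm))

/-- **The chart rings off the double line are regular**: `ChartRing F 2 ≅ k[y]/(g₂)`, `ChartRing F 3 ≅ k[y]/(g₃)`. [folklore] -/
theorem isRegularRing_chartRing_of_two_le (c : Fin 4) (hc : 2 ≤ (c : ℕ)) :
    IsRegularRing (ChartRing (NodalCone.form k) c (isHomogeneous_form k)) := by
  have hc' : c = 2 ∨ c = 3 := by
    fin_cases c <;> simp at hc ⊢
  rcases hc' with rfl | rfl
  · obtain ⟨θ, -⟩ := HypersurfaceSpecimen.exists_chartQuotEquiv (NodalCone.form k) (isHomogeneous_form k) 2 (g₂ k)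
      (dehomogenize_form_two k) (radical_span_g₂ k)
    haveI := isRegularRing_quotient_g₂ k
    exact IsRegularRing.of_ringEquiv θ.symm
  · obtain ⟨θ, -⟩ := HypersurfaceSpecimen.exists_chartQuotEquiv (NodalCone.form k) (isHomogeneous_form k) 3 (g₃ k)
      (dehomogenize_form_three k) (radical_span_g₃ k)
    haveI := isRegularRing_quotient_g₃ k
    exact IsRegularRing.of_ringEquiv θ.symm

/-! ## The certificates, through the generic double-line files -/

/-- **Every blow-up of `H` along `𝓘⟨Σ⟩ · 𝒪_H` is regular** — ONE application of `DoubleLine.isRegular_of_isBlowup_comap_vanishingIdeal` (p645742); the same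
polynomial chart `g` serves `D₊(x₀)` and `D₊(x₁)`. [folklore] -/
theorem isRegular_blowups :
    ∀ (Z : Scheme.{0}) (ρ : Z ⟶ (hypersurface (NodalCone.form k)).left),
      IsBlowup ρ ((vanishingIdeal (⟨_, WhitneyCubic.isClosed_doubleLine k⟩ :
        Closeds (Literature.AlgebraicGeometry.Motives.projectiveSpace 3 k).left)).comap (hypersurfaceι (NodalCone.form k)).left) →
      Scheme.IsRegular Z :=
  DoubleLine.isRegular_of_isBlowup_comap_vanishingIdeal k (NodalCone.form k) (isHomogeneous_form k) three_pos
    (isRegularRing_chartRing_of_two_le k) (g k) (g k) (dehomogenize_form_zero k) (dehomogenize_form_one k)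
    (radical_span_g k) (radical_span_g k) (isRegularRing_chart₁ k) (isRegularRing_chart₂ k) (isRegularRing_chart₁ k)
    (isRegularRing_chart₂ k)

/-- **THE B‴ NOSE PREDICATE HOLDS FOR THE NODAL CUBIC CONE** `H = V₊((x₀ + x₁)x₂x₃ + x₂³ + x₃³) ⊂ ℙ³_K` (ANY field `K`, every characteristic): by the
double-line certificate schema `DoubleLine.reachNoseTowerBTriplePrime_of_isRegular_blowups` (p645692). Fourth kernel inhabitant of the chain's nose predicate.
[OURS · L1 W4.5b] -/
theorem reachNoseTowerBTriplePrime_nodalCone (K : Type) [Field K] :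
    ReachNoseTowerBTriplePrime K 3 (hypersurface (NodalCone.form K)).left (hypersurfaceι (NodalCone.form K)).left :=
  DoubleLine.reachNoseTowerBTriplePrime_of_isRegular_blowups K (NodalCone.form K) (isHomogeneous_form K) (prime_form K)
    (form_mem_span K) (X_two_not_mem_span_form K) (isRegular_blowups K)

/-- **EL♮ FOR THE NODAL CUBIC CONE THROUGH THE REGISTERED RUNG** (`K` algebraically closed of characteristic `p`, ANY `p`): `ELNatAt p K 3 H ι`, by
`DoubleLine.elNatAt_of_isRegular_blowups` (p645692). [OURS · L1 W4.5b] -/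
theorem elNatAt_nodalCone (p : ℕ) (hp : p.Prime) (K : Type) [Field K] [CharP K p] [IsAlgClosed K] :
    Theorems.EquisingularLift.ELNatAt p K 3 (hypersurface (NodalCone.form K)).left (hypersurfaceι (NodalCone.form K)).left :=
  DoubleLine.elNatAt_of_isRegular_blowups K p hp (NodalCone.form K) (isHomogeneous_form K) three_pos (prime_form K)
    (form_mem_span K) (X_two_not_mem_span_form K) (radical_dehomogenize K) (isRegular_blowups K)

end NodalCone

end Summit.ResolutionOfSingularities.ResolutionOfSingularities.Cruxes.EquisingularLiftNat.Sections

end
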